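import Mathlib
import HarnessLib
import Summits.ValiantsHypothesis.ValiantsHypothesis.Theses.MonotoneRestoration
import Literature.Computability.AlgebraicComplexity.ArithCircuit
import Literature.Computability.AlgebraicComplexity.ArithCircuitProofs
import Literature.Computability.AlgebraicComplexity.MonotoneStructure
import Literature.Computability.AlgebraicComplexity.PermanentIrreducible
import Literature.ModelTheory.FiniteModelTheory.CkEquiv
import Summits.ValiantsHypothesis.ValiantsHypothesis.Theorems.MonotoneRestorationMonotoneRestorationQPCosetCount
import Summits.ValiantsHypothesis.ValiantsHypothesis.Theorems.MonotoneRestorationMonotoneRestorationQPSymmetricLB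
import Summits.ValiantsHypothesis.ValiantsHypothesis.Theorems.MonotoneRestorationMonotoneRestorationQPSupportSymmetrisation
import Summits.ValiantsHypothesis.ValiantsHypothesis.Theorems.MonotoneRestorationMonotoneRestorationQPSparseRegime
import Summits.ValiantsHypothesis.ValiantsHypothesis.Theorems.MonotoneRestorationMonotoneRestorationQPBeta
import Literature.Computability.AlgebraicComplexity.SymmetricArithCircuit
import Literature.Computability.AlgebraicComplexity.DawarWilsenach2025Proofs
import Literature.GroupTheory.PermutationGroups.SmallIndexSubgroups
import Summits.ValiantsHypothesis.ValiantsHypothesis.Theorems.MonotoneRestorationQP.Negative.LoadBearing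
import Summits.ValiantsHypothesis.ValiantsHypothesis.Theorems.MonotoneRestorationMonotoneRestorationQPPermSupportCount

/-! TTRL-lite variant V19132 of stmt-ValiantsHypothesis-15886 -/

namespace Summit.ValiantsHypothesis.ValiantsHypothesis.Theorems

open Summit.ValiantsHypothesis.ValiantsHypothesis.Theses.MonotoneRestoration
open Literature.Computability.AlgebraicComplexity

/-- Value of `e_k(R_1, …, R_n)` (elementary symmetric polynomial in the row sums
`R_i = ∑_j x_{ij}`) at the all-ones matrix: each row sum evaluates to `n`, so the value is
`C(n,k) · n^k`. TTRL-lite variant V19132 of `stub_esymmRowSums_structure`. -/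
theorem stub_esymmRowSums_structure_var19132 :
    ∀ (n k : ℕ), MvPolynomial.eval (fun _ : Fin n × Fin n => (1 : NNReal))
      (MvPolynomial.bind₁ (fun i : Fin n => ∑ j : Fin n, MvPolynomial.X (i, j))
        (MvPolynomial.esymm (Fin n) NNReal k)) = (n.choose k : NNReal) * (n : NNReal) ^ k := by
  intro n k
  have h1 : MvPolynomial.eval (fun _ : Fin n × Fin n => (1 : NNReal))
      (MvPolynomial.bind₁ (fun i : Fin n => ∑ j : Fin n, MvPolynomial.X (i, j))
        (MvPolynomial.esymm (Fin n) NNReal k))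
      = MvPolynomial.eval (fun _ : Fin n => (n : NNReal)) (MvPolynomial.esymm (Fin n) NNReal k) := by
    simp only [MvPolynomial.eval, MvPolynomial.eval₂Hom_bind₁, map_sum, MvPolynomial.eval₂Hom_X',
      Finset.sum_const, Finset.card_univ, Fintype.card_fin, nsmul_eq_mul, mul_one]
  rw [h1, MvPolynomial.esymm, map_sum]
  have h : ∀ t ∈ Finset.powersetCard k (Finset.univ : Finset (Fin n)),
      MvPolynomial.eval (fun _ : Fin n => (n : NNReal)) (∏ i ∈ t, MvPolynomial.X i)
        = (n : NNReal) ^ k := by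
    intro t ht
    rw [map_prod]
    simp only [MvPolynomial.eval_X, Finset.prod_const]
    rw [(Finset.mem_powersetCard.mp ht).2]
  rw [Finset.sum_congr rfl h, Finset.sum_const, Finset.card_powersetCard, Finset.card_univ,
    Fintype.card_fin, nsmul_eq_mul]

end Summit.ValiantsHypothesis.ValiantsHypothesis.Theorems
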